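import Summits.HubbardSuperconductivity.HubbardSuperconductivity.Theses.LiebTwin
import Summits.HubbardSuperconductivity.HubbardSuperconductivity.Theorems.EnslavedA1gA1gSlavingTransfer
import Literature.Barriers.HubbardSuperconductivity.PureModelStripeCompetitionProofs

/-!
# Stub `stub_extendedSSubordinate` of crux `DWavePolarisedDiscordance` (stmt-HubbardSuperconductivity-15314),
# line `registered`: REDUCTION of the channel-selection stub to the shared open crux `NoOnsiteODLRO`

Helper (`--supports stmt-HubbardSuperconductivity-15314`, registered sub-goal
`stub_extendedSSubordinate_of_noOnsiteODLRO`). The registered stub (channel selection,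
`X ≤ C·D + εL⁴`) is NOT proved unconditionally here. What this file proves, sorry-free, is the
reduction

  `Theses.LiebTwin.NoOnsiteODLRO` (= `Theses.EnslavedA1g.NoOnsiteODLRO`, item stmt-0933, OPEN)
    ⟹ the stub, with `C = 0`,

via (i) the per-state slaving bound `‖P_{s'}φ‖² ≤ K L² ‖P_sφ‖ + U² ‖P_sφ‖² / 4` for every
normalised sector eigenvector (`enslavedA1gIdentity_proof` + `two_mul_eucNorm_sq_le_of_slaving` +
the locality bound, all landed in `Theorems/EnslavedA1gA1gSlavingTransfer.lean`), and (ii) the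
padding argument turning the sequence-form crux into its uniform-over-ground-states form on the box
(`exists_unit_isGroundStateInSector_hubbardTorus`). No tree fact bounds the extended-`s` pair order
by the `d`-wave pair order; the only handle on `P_{s'}` is its enslavement to the ON-SITE field `P_s`.
Consequence for the route: `Theses.LiebTwin.closes` already takes `hNo : NoOnsiteODLRO`, so at route
level this stub costs nothing beyond the sibling crux stmt-0933 (worker a7cdb6a1, lead c1, 2026-08-17).
-/

noncomputable section

-- `dupNamespace`: the summit and the problem are both named `HubbardSuperconductivity` (layout D-0022)
set_option linter.dupNamespace false

namespace Summit.HubbardSuperconductivity.HubbardSuperconductivity.Theorems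

open Matrix
open Literature.MathematicalPhysics.QuantumLattice
open scoped Matrix MatrixOrder Matrix.Norms.L2Operator ComplexOrder
open Summit.HubbardSuperconductivity.EnslavedA1g
open Summit.HubbardSuperconductivity.HubbardSuperconductivity.Theses

/-- **Per-state slaving bound.** For `L ≥ 3`, every real `U` and every normalised eigenvector `φ`
of `hubbardTorus 2 L 1 U` (in particular every sector ground state):
`‖P_{s'}φ‖² ≤ K L² ‖P_sφ‖ + U² ‖P_sφ‖² / 4`, `K = K(U)` the locality constant of
`exists_norm_commutator_hubbardTorus_pairField_le`. Zhang, PRL 65 (1990) 120; Tian, J. Phys. A 27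
(1994) 6677. [folklore] -/
theorem extendedS_sq_le_of_eigen {U K : ℝ}
    (hK : ∀ (L : ℕ) [NeZero L],
      ‖hubbardTorus 2 L 1 U * pairField extendedSWave L -
          pairField extendedSWave L * hubbardTorus 2 L 1 U‖ ≤ K * (L : ℝ) ^ 2)
    (L : ℕ) [NeZero L] (hL3 : 2 < L) {E : ℝ} (φ : Fock (Orb (FermionTorus 2 L)))
    (hφ1 : star φ ⬝ᵥ φ = 1) (hHφ : hubbardTorus 2 L 1 U *ᵥ φ = (E : ℂ) • φ) :
    eucNorm (pairField extendedSWave L *ᵥ φ) ^ 2 ≤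
      K * (L : ℝ) ^ 2 * eucNorm (pairField sWave L *ᵥ φ) +
        U ^ 2 * eucNorm (pairField sWave L *ᵥ φ) ^ 2 / 4 := by
  have hHerm : (hubbardTorus 2 L 1 U).IsHermitian :=
    hubbardTorus_isHermitian (hamiltonian_isHermitian_and_commute_holds _) 1 U
  have hId := enslavedA1gIdentity_proof L hL3 U
  have hkey := two_mul_eucNorm_sq_le_of_slaving hHerm hId hφ1 hHφ
  have hB0 : 0 ≤ eucNorm (pairField sWave L *ᵥ φ) := eucNorm_nonneg _
  have h2A : 2 * eucNorm (pairField extendedSWave L *ᵥ φ) ^ 2 ≤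
      K * (L : ℝ) ^ 2 * eucNorm (pairField sWave L *ᵥ φ) +
        |U| * eucNorm (pairField extendedSWave L *ᵥ φ) * eucNorm (pairField sWave L *ᵥ φ) :=
    hkey.trans (add_le_add (mul_le_mul_of_nonneg_right (hK L) hB0) le_rfl)
  have h := sq_le_of_two_mul_sq_le h2A
  rwa [sq_abs] at h

/-- **Uniform no-on-site-condensate ⇒ the stub with `C = 0`.** The hypothesis is the uniform
(over all normalised sector ground states, on the box) form of "no on-site `k = 0` pair
condensate": `∀ (U,δ) ∈ box ∀ ε > 0, eventually in even L, every normalised sector ground state φ has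
F_s(φ) ≤ ε L⁴`. With the per-state slaving bound at tolerance `t²`, `t = min 1 (ε/(K + U²/4 + 1))`,
`F_xs(φ) ≤ K L²·(t L²) + U² (t L²)²/4 ≤ ε L⁴`. [folklore] -/
theorem stub_extendedSSubordinate_of_uniformNoOnsite
    (hNo : ∀ U ∈ Set.Ioc (0 : ℝ) 4, ∀ δ ∈ Set.Icc (1 / 10 : ℝ) (3 / 10), ∀ ε : ℝ, 0 < ε → ∃ L₀ : ℕ,
      ∀ (L : ℕ) [NeZero L], L₀ ≤ L → Even L → ∀ φ : Fock (Orb (FermionTorus 2 L)),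
        star φ ⬝ᵥ φ = 1 →
          IsGroundStateInSector (hubbardTorus 2 L 1 U) (2 * ⌊(1 - δ) * (L : ℝ) ^ 2 / 2⌋₊) 0 φ →
            (expect ((pairField sWave L)ᴴ * pairField sWave L) φ).re ≤ ε * (L : ℝ) ^ 4) :
    ∀ U ∈ Set.Ioc (0 : ℝ) 4, ∀ δ ∈ Set.Icc (1 / 10 : ℝ) (3 / 10), ∃ C : ℝ, 0 ≤ C ∧ ∀ ε : ℝ, 0 < ε → ∃ L₀ : ℕ, ∀ (L : ℕ) [NeZero L], L₀ ≤ L → Even L → ∀ φ : Fock (Orb (FermionTorus 2 L)), star φ ⬝ᵥ φ = 1 → IsGroundStateInSector (hubbardTorus 2 L 1 U) (2 * ⌊(1 - δ) * (L : ℝ) ^ 2 / 2⌋₊) 0 φ → (expect ((pairField extendedSWave L)ᴴ * pairField extendedSWave L) φ).re ≤ C * (expect ((pairField dWaveFormFactor L)ᴴ * pairField dWaveFormFactor L) φ).re + ε * (L : ℝ) ^ 4 := by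
  intro U hU δ hδ
  refine ⟨0, le_rfl, fun ε hε => ?_⟩
  obtain ⟨K, hK0, hK⟩ := exists_norm_commutator_hubbardTorus_pairField_le extendedSWave U
  have hMpos : 0 < K + U ^ 2 / 4 + 1 := by positivity
  obtain ⟨t, htpos, ht1, htM⟩ : ∃ t : ℝ, 0 < t ∧ t ≤ 1 ∧ t ≤ ε / (K + U ^ 2 / 4 + 1) :=
    ⟨min 1 (ε / (K + U ^ 2 / 4 + 1)), lt_min one_pos (div_pos hε hMpos), min_le_left _ _,
      min_le_right _ _⟩
  obtain ⟨L₀, hL₀⟩ := hNo U hU δ hδ (t ^ 2) (by positivity)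
  refine ⟨max L₀ 3, fun L _ hL hLeven φ hφ1 hGS => ?_⟩
  have hL3 : 2 < L := lt_of_lt_of_le (by norm_num) ((le_max_right L₀ 3).trans hL)
  have hy := hL₀ L ((le_max_left L₀ 3).trans hL) hLeven φ hφ1 hGS
  have hA2 : (expect ((pairField extendedSWave L)ᴴ * pairField extendedSWave L) φ).re =
      eucNorm (pairField extendedSWave L *ᵥ φ) ^ 2 :=
    re_star_dotProduct_conjTranspose_mul_self_mulVec _ _
  have hB2 : (expect ((pairField sWave L)ᴴ * pairField sWave L) φ).re =
      eucNorm (pairField sWave L *ᵥ φ) ^ 2 :=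
    re_star_dotProduct_conjTranspose_mul_self_mulVec _ _
  have hA2le := extendedS_sq_le_of_eigen hK L hL3 φ hφ1 hGS.2.2
  rw [hA2, zero_mul, zero_add]
  rw [hB2] at hy
  set A : ℝ := eucNorm (pairField extendedSWave L *ᵥ φ) with hA
  set B : ℝ := eucNorm (pairField sWave L *ᵥ φ) with hB
  have hA0 : 0 ≤ A := eucNorm_nonneg _
  have hB0 : 0 ≤ B := eucNorm_nonneg _
  have hLpos : (0 : ℝ) < L := by exact_mod_cast (lt_trans (by norm_num) hL3 : 0 < L)
  set ℓ : ℝ := (L : ℝ) ^ 2 with hℓ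
  have hℓpos : 0 < ℓ := by positivity
  have hL4 : (L : ℝ) ^ 4 = ℓ ^ 2 := by rw [hℓ]; ring
  rw [hL4] at hy ⊢
  have hBsq : B ^ 2 ≤ (t * ℓ) ^ 2 := by nlinarith [hy]
  have hBt : B ≤ t * ℓ := (sq_le_sq₀ hB0 (by positivity)).1 hBsq
  have ht2 : t ^ 2 ≤ t := by nlinarith
  have hKU : (K + U ^ 2 / 4) * t ≤ ε := by
    calc (K + U ^ 2 / 4) * t ≤ (K + U ^ 2 / 4) * (ε / (K + U ^ 2 / 4 + 1)) :=
          mul_le_mul_of_nonneg_left htM (by positivity)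
      _ ≤ (K + U ^ 2 / 4 + 1) * (ε / (K + U ^ 2 / 4 + 1)) :=
          mul_le_mul_of_nonneg_right (by linarith) (div_nonneg hε.le hMpos.le)
      _ = ε := mul_div_cancel₀ ε hMpos.ne'
  calc A ^ 2 ≤ K * ℓ * B + U ^ 2 * B ^ 2 / 4 := hA2le
    _ ≤ K * ℓ * (t * ℓ) + U ^ 2 * (t * ℓ) ^ 2 / 4 := by gcongr
    _ = (K * t + U ^ 2 / 4 * t ^ 2) * ℓ ^ 2 := by ring
    _ ≤ (K * t + U ^ 2 / 4 * t) * ℓ ^ 2 := by gcongr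
    _ = (K + U ^ 2 / 4) * t * ℓ ^ 2 := by ring
    _ ≤ ε * ℓ ^ 2 := mul_le_mul_of_nonneg_right hKU (by positivity)

/-- **Sequence form ⇒ uniform form** of "no on-site condensate" on the box: if the uniform form
failed at `(U, δ, ε)`, pick a violating normalised ground state at each bad even side and pad with
arbitrary normalised sector ground states elsewhere (they exist on every torus,
`exists_unit_isGroundStateInSector_hubbardTorus`); the resulting admissible sequence contradicts
the crux at tolerance `ε / 2`. [folklore] -/
theorem uniformNoOnsiteOnBox_of_noOnsiteODLRO (h : LiebTwin.NoOnsiteODLRO) :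
    ∀ U ∈ Set.Ioc (0 : ℝ) 4, ∀ δ ∈ Set.Icc (1 / 10 : ℝ) (3 / 10), ∀ ε : ℝ, 0 < ε → ∃ L₀ : ℕ,
      ∀ (L : ℕ) [NeZero L], L₀ ≤ L → Even L → ∀ φ : Fock (Orb (FermionTorus 2 L)),
        star φ ⬝ᵥ φ = 1 →
          IsGroundStateInSector (hubbardTorus 2 L 1 U) (2 * ⌊(1 - δ) * (L : ℝ) ^ 2 / 2⌋₊) 0 φ →
            (expect ((pairField sWave L)ᴴ * pairField sWave L) φ).re ≤ ε * (L : ℝ) ^ 4 := by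
  classical
  intro U hU δ hδ ε hε
  by_contra hcon
  push Not at hcon
  have hδ' : (-1 : ℝ) ≤ δ := by linarith [hδ.1]
  -- the violating predicate (carrying its own `NeZero` witness) and the padding ground states
  let P : ∀ L : ℕ, Fock (Orb (FermionTorus 2 L)) → Prop := fun L φ =>
    ∃ _hL : NeZero L, star φ ⬝ᵥ φ = 1 ∧
      IsGroundStateInSector (hubbardTorus 2 L 1 U) (2 * ⌊(1 - δ) * (L : ℝ) ^ 2 / 2⌋₊) 0 φ ∧
        ε * (L : ℝ) ^ 4 < (expect ((pairField sWave L)ᴴ * pairField sWave L) φ).re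
  have hgood : ∀ L : ℕ, ∃ φ : Fock (Orb (FermionTorus 2 L)), star φ ⬝ᵥ φ = 1 ∧
      IsGroundStateInSector (hubbardTorus 2 L 1 U) (2 * ⌊(1 - δ) * (L : ℝ) ^ 2 / 2⌋₊) 0 φ :=
    fun L => Literature.Barriers.HubbardSuperconductivity.exists_unit_isGroundStateInSector_hubbardTorus
      U L _ (Literature.Barriers.HubbardSuperconductivity.natFloor_filling_le_sq hδ' L)
  let ψ : ∀ L : ℕ, Fock (Orb (FermionTorus 2 L)) := fun L =>
    if hb : ∃ φ, P L φ then hb.choose else (hgood L).choose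
  have hψadm : ∀ L : ℕ, star (ψ L) ⬝ᵥ ψ L = 1 ∧
      IsGroundStateInSector (hubbardTorus 2 L 1 U) (2 * ⌊(1 - δ) * (L : ℝ) ^ 2 / 2⌋₊) 0 (ψ L) := by
    intro L
    by_cases hb : ∃ φ, P L φ
    · simp only [ψ, dif_pos hb]
      obtain ⟨_, h1, h2, -⟩ := hb.choose_spec
      exact ⟨h1, h2⟩
    · simp only [ψ, dif_neg hb]
      exact (hgood L).choose_spec
  have hψbad : ∀ L : ℕ, (∃ φ, P L φ) → P L (ψ L) := by
    intro L hb
    simp only [ψ, dif_pos hb]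
    exact hb.choose_spec
  -- the crux along the padded sequence, at tolerance ε/2
  obtain ⟨L₀, hL₀⟩ := h U δ hU.1 ⟨by linarith [hδ.1], by linarith [hδ.2]⟩
    (fun L => 2 * ⌊(1 - δ) * (L : ℝ) ^ 2 / 2⌋₊) ψ (fun L _ => ⟨rfl, hψadm L⟩) (ε / 2) (half_pos hε)
  obtain ⟨L, hLne, hL₀L, hLeven, φ, hφ1, hφGS, hφbad⟩ := hcon L₀
  obtain ⟨_, -, -, h2⟩ := hψbad L ⟨φ, hLne, hφ1, hφGS, hφbad⟩
  have h1 := @hL₀ L hLne hLeven hL₀L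
  have hLpos : (0 : ℝ) < (L : ℝ) := by exact_mod_cast Nat.pos_of_ne_zero (NeZero.ne L)
  have hL4 : (0 : ℝ) < (L : ℝ) ^ 4 := by positivity
  rw [div_le_iff₀ hL4] at h1
  have h2' : ε * (L : ℝ) ^ 4 <
      (expect ((pairField sWave L)ᴴ * pairField sWave L) (ψ L)).re := h2
  nlinarith [h1, h2', hL4, hε]

/-- **The reduction.** The shared open crux `NoOnsiteODLRO` (stmt-HubbardSuperconductivity-0933,
hypothesis `hNo` of `Theses.LiebTwin.closes`) implies the registered stub
`stub_extendedSSubordinate` with `C = 0`. [folklore] -/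
theorem stub_extendedSSubordinate_of_noOnsiteODLRO :
    Summit.HubbardSuperconductivity.HubbardSuperconductivity.Theses.LiebTwin.NoOnsiteODLRO →
    ∀ U ∈ Set.Ioc (0 : ℝ) 4, ∀ δ ∈ Set.Icc (1 / 10 : ℝ) (3 / 10), ∃ C : ℝ, 0 ≤ C ∧ ∀ ε : ℝ, 0 < ε → ∃ L₀ : ℕ, ∀ (L : ℕ) [NeZero L], L₀ ≤ L → Even L → ∀ φ : Fock (Orb (FermionTorus 2 L)), star φ ⬝ᵥ φ = 1 → IsGroundStateInSector (hubbardTorus 2 L 1 U) (2 * ⌊(1 - δ) * (L : ℝ) ^ 2 / 2⌋₊) 0 φ → (expect ((pairField extendedSWave L)ᴴ * pairField extendedSWave L) φ).re ≤ C * (expect ((pairField dWaveFormFactor L)ᴴ * pairField dWaveFormFactor L) φ).re + ε * (L : ℝ) ^ 4 :=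
  fun h => stub_extendedSSubordinate_of_uniformNoOnsite (uniformNoOnsiteOnBox_of_noOnsiteODLRO h)

end Summit.HubbardSuperconductivity.HubbardSuperconductivity.Theorems

end
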